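import Summits.QuantumFields.YangMills.Theorems.FluctuationComparisonRegPrIntLS2BetaLiftCurvatureLocalTower
import HarnessLib

/-!
# S2β · THE SUP CHAIN ∕ (D-stage) — THE `ρA` REGION LETTER OF FILE P FROM PARENT BOX SUPS: ✓`rhoTilde_of_regionLetters`'s `hρA` binder inhabited at an
# EXPLICIT `ρA t B := √(L⁻⁴·(4·ρP_par(t,B)² + 1536·(2σ_t)²·((1+σ_t²∕3)·mC_par(t,B))²))` by px12 g26's ✓p837174 R′ per child plaquette

Cell `ym3-torus` (YM ladder rung R3 = continuum `SU(2)` Yang–Mills on the three-torus at fixed lattice data — a RUNG: NOT d = 4, NOT infinite volume,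
NOT a mass gap, NOT Clay).  Width seat «width 21» `ym3-torus-px21` (gen 25), FREE px helper on crux `stmt-QuantumFields-20520`
(`…Theses.UnitScaleTilt.FluctuationComparisonRegPrIntL`), LINE g18-1 S2β.  px12 g26 2026-08-31 23:15:14Z: «with ✓p837136 (k2′) the ρA column is yours to assemble».
`--kind proof --supports stmt-QuantumFields-20520 --as helper`, count-neutral, DEFINITION-FREE (0 `def`, 0 `instance`, 0 `notation`, 0 `sorry`, default heartbeats).

WHERE IT DOCKS.  FILE P ✓p836058 `rhoTilde_of_regionLetters` turns ✓p835795 `discRow'`'s `hρ` (the ρ̃ letter) into region letters `hρS`, `hρA`, `hmA` and size letters;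
`hρA` asks for a bound `ρA t B` on the relative LIFT curvature `dist1 (P_{A_W} q·(P_{A_U} q)⁻¹)` over the block-pair region of `B` at the child height
`s = K−(J+t+1)`.  R′ ✓p837174 `dist1_relLift_sq_le_local_tower` bounds that square, per child plaquette `q`, by `L⁻⁴(4ρP² + 1536(2σ)²((1+σ²∕3)mC)²)` from two numbers
`ρP`, `mC` bounding the PARENT relative plaquettes ∕ relative chords on `q`'s stencil (column plaquettes `colW ≠ 0`, their four bonds, the hat feeders `wt s b e ≠ 0`).
THIS FILE chooses `ρP := ρP_par(t,B)`, `mC := mC_par(t,B)` = the Pi-sups of exactly those parent quantities over exactly those supports, `q` over the region — so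
the three letters hold by `norm_le_pi_norm` — and `ρA t B := √(…)`.  The BUDGET of the column is the next file: `mC_par(t,B) ≤ ‖𝟙[PBOX³_t(B)]·η_{J+t}‖` (support
geometry ✓`colW_support`∕✓`hatW_support` + ✓p837136 (k2′) + ✓`mShare_le`) and `ρP_par(t,B) ≤` px10 g26's (k1) read cell ONE LEVEL UP (thickness `2L+1 ≥ 3+3`), `= 0` at
`t = 0` on the fibre.

WHAT IS PROVED (sorry-free).  ★★★`hρA_of_parentSups` — binders: R′'s tower binders VERBATIM (`U₀ ζ wt lift U₁ g g₀ hwt hlift hT3 hT3' hU₀`), `σ : ℕ → ℝ` with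
`hσ4 : ∀ t, σ t ≤ 1∕4` and the parent arc letters `hσ`, `hσ'` (R′'s texts under `∀ t < K−J`, `σ ↦ σ t`) ⟹ FILE P's `hρA` binder text VERBATIM at the explicit `ρA` (module
docstring; β-reduces).  Proof: `Real.le_sqrt` + R′ + three `norm_le_pi_norm`.

HONEST SCOPE.  Plumbing of a landed per-plaquette estimate into a landed binder; the tower binders and arc letters are HYPOTHESES; nothing of Bałaban's
renormalisation-group analysis is asserted or proved ([Balaban1985RegularSpaces] (1.29) p.81 and [Balaban1985Variational] (34) p.283 are the printed objects;
[Balaban1987RG1] (0.3)–(0.4) pp.252–253 the lattice conventions); the ρA∕ρ̃-column BUDGET, (SRC-P), `hArc`, (ST⁗)∕LOC⁗, GAP♯∘ (`stub_uniformFibreGapOrbit`, registry 3732b7df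
UNTOUCHED), the five registered stubs (0∕5), S2β, 20520, 19936, 19200, `YM3TorusSU2` are NOT proved; no registered stub is closed; rung R3 — NOT d = 4, NOT infinite
volume, NOT a mass gap, NOT Clay; the Yang–Mills mass gap is NOT proved.
-/

set_option autoImplicit false

namespace Summit.QuantumFields.YangMills.Theorems.FluctuationComparisonRegPrIntLS2BetaRhoAColumnLocal

open Finset
open scoped Real
open Literature.MathematicalPhysics.QuantumLattice (su2Quat)
open Literature.MathematicalPhysics.QuantumFieldTheory.Balaban1983to89
open T4Continuum T3ContinuumYM3Torus T3TiltDescent T3LevelShift BlockAveraging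
open B10Eq27TorusAxialLog (rel axialT)
open T4CubeChartGnomonic (SU2)
open T4HaarSU2ExpChart (expPoint)
open T4ExpWindowSmallField (logVec)
open T3UnitLawDensityEML (ℰp)
open Summit.QuantumFields.YangMills.Theorems.FluctuationComparisonRegPrIntLS2BetaLiftCurvatureLocalTower (dist1_relLift_sq_le_local_tower)

section Tower

variable {F : T3Family}

/-- ★★★ **THE `ρA` REGION LETTER OF FILE P FROM PARENT BOX SUPS** (px12 g26 2026-08-31 23:15:14Z «the ρA column is yours to assemble»): under R′'s tower binders
(✓p837174 `dist1_relLift_sq_le_local_tower`: hat weights `hwt`, `hlift`, (T3)×2, bottom relation) and PER-LEVEL parent arc letters `σ t ≤ 1∕4`, the `hρA` binder of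
✓p836058 `rhoTilde_of_regionLetters` HOLDS (conclusion = that binder's text VERBATIM) at the EXPLICIT
`ρA t B := √(L⁻²·L⁻²·(4·ρP_par(t,B)² + 1536·(2σ_t)²·((1+σ_t²∕3)·mC_par(t,B))²))`, where `ρP_par(t,B)` ∕ `mC_par(t,B)` are the Pi-sups of the PARENT relative
plaquettes ∕ relative chords over EXACTLY R′'s supports (column plaquettes `colW ≠ 0` through a box plaquette `q`; their four bonds; the hat feeders `wt s b e ≠ 0` of the
four bonds of `q`), `q` ranging over FILE P's block-pair region of `B` — so R′'s three letters are inhabited by `norm_le_pi_norm` and nothing else.  The budget of this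
column (`Σ_B ρP_par² ∕ mC_par²` against (k1) one level up ∕ the parent READ′ energy via ✓p837136 (k2′) + ✓`mShare_le`) is the next file; this one fixes the OBJECT.
[cite: Balaban1985RegularSpaces, (1.29) p.81; Balaban1985Variational, (34) p.283; Balaban1987RG1, (0.3)-(0.4) p.252-253] -/
theorem hρA_of_parentSups {J K : ℕ} (U₀ : GaugeField (F.P K) 0 (Matrix.specialUnitaryGroup (Fin 2) ℂ)) (ζ : PBond (F.P K) 0 → EuclideanSpace ℝ (Fin 3))
    (wt : (j : ℕ) → PBond (F.P K) j → PBond (F.P K) (j + 1) → ℝ)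
    (lift : (j : ℕ) → GaugeField (F.P K) (j + 1) SU2 → GaugeField (F.P K) j SU2)
    (U₁ : GaugeField (F.P K) 0 SU2) (g g₀ : (j : ℕ) → Site (F.P K) j → SU2)
    (hwt : ∀ j b e, wt j b e = if e.dir = b.dir ∧ (b.src b.dir - emb e.src b.dir).val < (F.P K).L then
        ∏ ν ∈ Finset.univ.erase b.dir, max 0 (1 - ((rel (emb e.src) b.src ν).natAbs : ℝ) / (F.P K).L) else 0)
    (hlift : ∀ j X b, lift j X b = expPoint (∑ e, wt j b e • ((((F.P K).L : ℕ) : ℝ)⁻¹ • logVec (su2Quat (X e)))))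
    (hT3 : ∀ X : GaugeField (F.P K) 0 SU2, ∀ j, j ≤ K - J →
      Averaging.iter (fun k => blockAvg (P := F.P K) (j := k) ℰp) j (GaugeField.gaugeAct (g 0) X) =
        GaugeField.gaugeAct (g j) (Averaging.iter (fun k => blockAvg (P := F.P K) (j := k) ℰp) j X))
    (hT3' : ∀ X : GaugeField (F.P K) 0 SU2, ∀ j, j ≤ K - J →
      Averaging.iter (fun k => blockAvg (P := F.P K) (j := k) ℰp) j (GaugeField.gaugeAct (g₀ 0) X) =
        GaugeField.gaugeAct (g₀ j) (Averaging.iter (fun k => blockAvg (P := F.P K) (j := k) ℰp) j X))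
    (hU₀ : U₀ = GaugeField.gaugeAct (fun x => (g 0 x)⁻¹ * g₀ 0 x) U₁)
    (σ : ℕ → ℝ) (hσ4 : ∀ t, σ t ≤ 1 / 4)
    (hσ : ∀ (t : ℕ), t < K - J → ∀ e : PBond (F.P K) ((K - (J + (t + 1))) + 1), ‖logVec (su2Quat (GaugeField.gaugeAct (g ((K - (J + (t + 1))) + 1)) (Averaging.iter (fun k => blockAvg (P := F.P K) (j := k) ℰp) ((K - (J + (t + 1))) + 1) (fun ℓ => expPoint (ζ ℓ) * U₀ ℓ)) e))‖ ≤ σ t)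
    (hσ' : ∀ (t : ℕ), t < K - J → ∀ e : PBond (F.P K) ((K - (J + (t + 1))) + 1), ‖logVec (su2Quat (GaugeField.gaugeAct (g₀ ((K - (J + (t + 1))) + 1)) (Averaging.iter (fun k => blockAvg (P := F.P K) (j := k) ℰp) ((K - (J + (t + 1))) + 1) U₁) e))‖ ≤ σ t) :
    ∀ (t : ℕ) (ht : t < K - J) (B : PBond (F.P J) 0) (q : Plaq (F.P K) (K - (J + (t + 1)))),
      (∃ ℓ' : PBond (F.P (J + (t + 1))) 0, (∃ z : Site (F.P (J + (t + 1))) 0,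
                (B14.Eq22Determines.blockIter (t + 1) z = (bondShift (F.sitesPerDir_eq (m := F.m) (K := J) (j := 0) (m' := F.m) (K' := J + (t + 1)) (j' := t + 1) (by omega)) B).src ∨ B14.Eq22Determines.blockIter (t + 1) z = (bondShift (F.sitesPerDir_eq (m := F.m) (K := J) (j := 0) (m' := F.m) (K' := J + (t + 1)) (j' := t + 1) (by omega)) B).tgt) ∧
                ∀ ν, (B10Eq27TorusAxialLog.rel z ℓ'.src ν).natAbs ≤ 2) ∧
        (blockOf q.src = blockOf (bondShift (F.sitesPerDir_eq (m := F.m) (K := J + (t + 1)) (j := 0) (m' := F.m) (K' := K) (j' := (K - (J + (t + 1)))) (by omega)) ℓ').src ∨ blockOf q.src = (blockOf (bondShift (F.sitesPerDir_eq (m := F.m) (K := J + (t + 1)) (j := 0) (m' := F.m) (K' := K) (j' := (K - (J + (t + 1)))) (by omega)) ℓ').src).shift (bondShift (F.sitesPerDir_eq (m := F.m) (K := J + (t + 1)) (j := 0) (m' := F.m) (K' := K) (j' := (K - (J + (t + 1)))) (by omega)) ℓ').dir)) →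
      dist1 (GaugeField.plaqHol (lift (K - (J + (t + 1))) (GaugeField.gaugeAct (g ((K - (J + (t + 1))) + 1)) (Averaging.iter (fun k => blockAvg (P := F.P K) (j := k) ℰp) ((K - (J + (t + 1))) + 1) (fun ℓ => expPoint (ζ ℓ) * U₀ ℓ)))) q * (GaugeField.plaqHol (lift (K - (J + (t + 1))) (GaugeField.gaugeAct (g₀ ((K - (J + (t + 1))) + 1)) (Averaging.iter (fun k => blockAvg (P := F.P K) (j := k) ℰp) ((K - (J + (t + 1))) + 1) U₁))) q)⁻¹) ≤ (fun (t : ℕ) (B : PBond (F.P J) 0) => if ht : t < K - J then Real.sqrt (((((F.P K).L : ℕ) : ℝ)⁻¹) ^ 2 * ((((F.P K).L : ℕ) : ℝ)⁻¹) ^ 2 * (4 * ‖(fun p : Plaq (F.P K) ((K - (J + (t + 1))) + 1) => if (∃ q : Plaq (F.P K) (K - (J + (t + 1))), ((∃ ℓ' : PBond (F.P (J + (t + 1))) 0, (∃ z : Site (F.P (J + (t + 1))) 0,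
                (B14.Eq22Determines.blockIter (t + 1) z = (bondShift (F.sitesPerDir_eq (m := F.m) (K := J) (j := 0) (m' := F.m) (K' := J + (t + 1)) (j' := t + 1) (by omega)) B).src ∨ B14.Eq22Determines.blockIter (t + 1) z = (bondShift (F.sitesPerDir_eq (m := F.m) (K := J) (j := 0) (m' := F.m) (K' := J + (t + 1)) (j' := t + 1) (by omega)) B).tgt) ∧
                ∀ ν, (B10Eq27TorusAxialLog.rel z ℓ'.src ν).natAbs ≤ 2) ∧
        (blockOf q.src = blockOf (bondShift (F.sitesPerDir_eq (m := F.m) (K := J + (t + 1)) (j := 0) (m' := F.m) (K' := K) (j' := (K - (J + (t + 1)))) (by omega)) ℓ').src ∨ blockOf q.src = (blockOf (bondShift (F.sitesPerDir_eq (m := F.m) (K := J + (t + 1)) (j := 0) (m' := F.m) (K' := K) (j' := (K - (J + (t + 1)))) (by omega)) ℓ').src).shift (bondShift (F.sitesPerDir_eq (m := F.m) (K := J + (t + 1)) (j := 0) (m' := F.m) (K' := K) (j' := (K - (J + (t + 1)))) (by omega)) ℓ').dir))) ∧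
          (if (q.src q.μ - emb p.src q.μ).val < (F.P K).L then (1 : ℝ) else 0) *
          (∏ ι ∈ (Finset.univ.erase q.μ).erase q.ν, max 0 (1 - ((rel (emb p.src) q.src ι).natAbs : ℝ) / (F.P K).L)) *
          (if (q.src q.ν - emb p.src q.ν).val < (F.P K).L then (1 : ℝ) else 0) ≠ 0 ∧ p.μ = q.μ ∧ p.ν = q.ν) then dist1 ((GaugeField.plaqHol (Averaging.iter (fun k => blockAvg (P := F.P K) (j := k) ℰp) ((K - (J + (t + 1))) + 1) U₀) p)⁻¹ * GaugeField.plaqHol (Averaging.iter (fun k => blockAvg (P := F.P K) (j := k) ℰp) ((K - (J + (t + 1))) + 1) (fun ℓ => expPoint (ζ ℓ) * U₀ ℓ : GaugeField (F.P K) 0 (Matrix.specialUnitaryGroup (Fin 2) ℂ))) p) else 0)‖ ^ 2 + 1536 * (σ t + σ t) ^ 2 * ((1 + σ t ^ 2 / 3) * ‖(fun e : PBond (F.P K) ((K - (J + (t + 1))) + 1) => if (∃ q : Plaq (F.P K) (K - (J + (t + 1))), ((∃ ℓ' : PBond (F.P (J + (t + 1))) 0, (∃ z : Site (F.P (J + (t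 + 1))) 0,
                (B14.Eq22Determines.blockIter (t + 1) z = (bondShift (F.sitesPerDir_eq (m := F.m) (K := J) (j := 0) (m' := F.m) (K' := J + (t + 1)) (j' := t + 1) (by omega)) B).src ∨ B14.Eq22Determines.blockIter (t + 1) z = (bondShift (F.sitesPerDir_eq (m := F.m) (K := J) (j := 0) (m' := F.m) (K' := J + (t + 1)) (j' := t + 1) (by omega)) B).tgt) ∧
                ∀ ν, (B10Eq27TorusAxialLog.rel z ℓ'.src ν).natAbs ≤ 2) ∧
        (blockOf q.src = blockOf (bondShift (F.sitesPerDir_eq (m := F.m) (K := J + (t + 1)) (j := 0) (m' := F.m) (K' := K) (j' := (K - (J + (t + 1)))) (by omega)) ℓ').src ∨ blockOf q.src = (blockOf (bondShift (F.sitesPerDir_eq (m := F.m) (K := J + (t + 1)) (j := 0) (m' := F.m) (K' := K) (j' := (K - (J + (t + 1)))) (by omega)) ℓ').src).shift (bondShift (F.sitesPerDir_eq (m := F.m) (K := J + (t + 1)) (j := 0) (m' := F.m) (K' := K) (j' := (K - (J + (t + 1)))) (by omega)) ℓ').dir))) ∧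
          ((∃ y : Site (F.P K) ((K - (J + (t + 1))) + 1), (if (q.src q.μ - emb y q.μ).val < (F.P K).L then (1 : ℝ) else 0) *
          (∏ ι ∈ (Finset.univ.erase q.μ).erase q.ν, max 0 (1 - ((rel (emb y) q.src ι).natAbs : ℝ) / (F.P K).L)) *
          (if (q.src q.ν - emb y q.ν).val < (F.P K).L then (1 : ℝ) else 0) ≠ 0 ∧ (e = ⟨y, q.μ⟩ ∨ e = ⟨y.shift q.μ, q.ν⟩ ∨ e = ⟨y.shift q.ν, q.μ⟩ ∨ e = ⟨y, q.ν⟩)) ∨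
           (∃ b : PBond (F.P K) (K - (J + (t + 1))), (b = ⟨q.src, q.μ⟩ ∨ b = ⟨q.src.shift q.μ, q.ν⟩ ∨ b = ⟨q.src.shift q.ν, q.μ⟩ ∨ b = ⟨q.src, q.ν⟩) ∧ wt (K - (J + (t + 1))) b e ≠ 0))) then dist1 ((Averaging.iter (fun k => blockAvg (P := F.P K) (j := k) ℰp) ((K - (J + (t + 1))) + 1) (fun ℓ => expPoint (ζ ℓ) * U₀ ℓ : GaugeField (F.P K) 0 (Matrix.specialUnitaryGroup (Fin 2) ℂ))) e * ((Averaging.iter (fun k => blockAvg (P := F.P K) (j := k) ℰp) ((K - (J + (t + 1))) + 1) U₀) e)⁻¹) else 0)‖) ^ 2)) else 0) t B := by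
  intro t ht B q hbox
  have hL0 : (0 : ℝ) ≤ (((F.P K).L : ℕ) : ℝ)⁻¹ := by positivity
  simp only [dif_pos ht]
  refine (Real.le_sqrt (GaugeGroup.dist1_nonneg _) (by positivity)).mpr ?_
  refine dist1_relLift_sq_le_local_tower U₀ ζ wt lift U₁ g g₀ hwt hlift hT3 hT3' hU₀ t ht (hσ4 t) (hσ t ht) (hσ' t ht) q ?_ ?_ ?_
  · -- column plaquettes
    intro y hy
    refine le_trans ?_ (norm_le_pi_norm _ ⟨y, q.μ, q.ν, q.hμν⟩)
    dsimp only
    rw [if_pos ⟨q, hbox, hy, rfl, rfl⟩, Real.norm_of_nonneg (GaugeGroup.dist1_nonneg _)]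
  · -- the four bonds of the column plaquettes
    intro y hy e he
    refine le_trans ?_ (norm_le_pi_norm _ e)
    rw [if_pos ⟨q, hbox, Or.inl ⟨y, hy, he⟩⟩, Real.norm_of_nonneg (GaugeGroup.dist1_nonneg _)]
  · -- the hat feeders of the four bonds of `q`
    intro b hb e he
    refine le_trans ?_ (norm_le_pi_norm _ e)
    rw [if_pos ⟨q, hbox, Or.inr ⟨b, hb, he⟩⟩, Real.norm_of_nonneg (GaugeGroup.dist1_nonneg _)]

end Tower

end Summit.QuantumFields.YangMills.Theorems.FluctuationComparisonRegPrIntLS2BetaRhoAColumnLocal
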